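import Mathlib.Analysis.SpecialFunctions.Integrals.Basic
import Literature.NumberTheory.Transcendental.KZLogCalculusProofs
import Literature.NumberTheory.Transcendental.KZDominatedFamilyRelations
import Literature.NumberTheory.Transcendental.KZBallPeelingAux
import Literature.NumberTheory.Transcendental.KZRulesAssociator
import Summits.KontsevichZagierPeriods.KontsevichZagierPeriods.Theorems.TerasomaMultiplicationBetaCancellationStubAffineMove
import Summits.KontsevichZagierPeriods.KontsevichZagierPeriods.Theorems.NormalFormPrinciple.Negative.WindowInvariant

/-!
# `NormalFormPrinciple` (stmt-KontsevichZagierPeriods-3869), line `SketchIdeator1` — the leaf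
# `stub_boxRigidity` in dimension one, IV: moves for rational integrands with `ℚ`-split denominators

Pure proof file (lead seat c3; `--supports` the crux). Moves for the layer of the leaf after the dlog
family (`…DlogLattice.lean`): box-rational representations `[(0,1), p/q]` whose denominator SPLITS
over `ℚ` (all poles rational, off `[0,1]`). Contents:

* point representations `[pt, r]` over `ℝ⁰` (`exists_ptCarrier`, `value_pt`, additivity, congruence);
* **the Newton–Leibniz move over the point** for an interval representation whose integrand has a
  `ℚ`-rational primitive `F = P_F/Q_F` (`slab_sub_pt_mem_relations`, registered sub-goal):
  `[(α,β), F'] ≡ [pt, F(β) − F(α)]` (rule 3 on the closed slab, rule 1a across the null endpoints);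
* affine moves of either orientation (`affine_sub_mem_relations`: `y = s x + t`, `s ≠ 0`, and the
  images of slabs);
* existence of `[(0,1), P/Q]` for `Q ≠ 0` on `[0,1]` (`exists_rep_unit`).

Sources: M. Kontsevich, D. Zagier, *Periods* (2001), §1.2 rules (1)–(3). No definitions are introduced.
-/

noncomputable section

open MeasureTheory Set Finset
open scoped Polynomial
open Literature.NumberTheory.Transcendental Literature.NumberTheory.Transcendental.KZ
open Literature.ModelTheory.ExponentialFields (IsSemialgebraic isSemialgebraic_univ)

namespace Summit.KontsevichZagierPeriods.HurwitzMicroSectors.NormalFormPrinciple.PiBox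

namespace Dlog

open Literature.NumberTheory.Transcendental.KZ.BallPeeling (isSemialgebraic_Ioo₁)
open Summit.KontsevichZagierPeriods.KontsevichZagierPeriods.BetaCancellationLine
  (aff_hasFDerivAt_chart aff_injective_chart aff_isSemialgebraicMapOn_chart)
open Summit.KontsevichZagierPeriods.HurwitzMicroSectors.NormalFormPrinciple.Negative
  (setIntegral_fin_one integrableOn_fin_one)
open Summit.KontsevichZagierPeriods.KontsevichZagierPeriods.BetaCancellationNegative
  (volume_setOf_apply_eq_zero)

/-! ## Point representations `[pt, r]` -/

/-- **A family of point representations** `[pt, r]` (`r ∈ ℚ`) over `ℝ⁰`: domain the point,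
integrand the constant `r`. [cite: KontsevichZagier2001, §1.1] -/
theorem exists_ptCarrier :
    ∃ Z : ℚ → IntegralRep 0, ∀ r, (Z r).domain = univ ∧ (Z r).integrand = fun _ => (r:ℝ) :=
  ⟨fun r =>
    { domain := univ
      integrand := fun _ => (r:ℝ)
      isSemialgebraic_domain := isSemialgebraic_univ
      isSemialgebraicFunOn_integrand := by
        simpa using isSemialgebraicFunOn_aeval
          (isSemialgebraic_univ (k := ℚ) (ι := Fin 0) (R := ℝ)) (MvPolynomial.C r)
      integrableOn := integrableOn_const (hs := by simp [volume_univ_fin_zero]) },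
    fun _ => ⟨rfl, rfl⟩⟩

/-- **Value of a point representation**: `[pt, r]` represents `r`. [cite: KontsevichZagier2001, §1.1] -/
theorem value_pt {r : ℝ} (Z : IntegralRep 0) (hd : Z.domain = univ) (hi : Z.integrand = fun _ => r) :
    Z.value = r := by
  rw [IntegralRep.value, hd, hi, Measure.restrict_univ, integral_const, measureReal_def,
    volume_univ_fin_zero]
  simp

/-- Additivity of point representations: `[pt, r + r'] − [pt, r] − [pt, r'] ∈ relations` (rule 1b).
[cite: KontsevichZagier2001, §1.2 rule (1)] -/
theorem pt_add_mem_relations {r r' : ℝ} (Z Z₁ Z₂ : IntegralRep 0) (hd : Z.domain = univ)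
    (hd₁ : Z₁.domain = univ) (hd₂ : Z₂.domain = univ) (hi : Z.integrand = fun _ => r + r')
    (hi₁ : Z₁.integrand = fun _ => r) (hi₂ : Z₂.integrand = fun _ => r') :
    of Z - of Z₁ - of Z₂ ∈ relations :=
  integrandAddRel_subset_relations ⟨0, Z, Z₁, Z₂, hd₁.trans hd.symm, hd₂.trans hd.symm,
    fun x _ => by simp [hi, hi₁, hi₂], rfl⟩

/-- `[pt, 0] ∈ relations`. [cite: KontsevichZagier2001, §1.2 rule (1)] -/
theorem pt_zero_mem_relations (Z : IntegralRep 0) (hi : Z.integrand = fun _ => (0:ℝ)) :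
    of Z ∈ relations :=
  of_mem_relations_of_eqOn_zero Z (by rw [hi]; exact fun _ _ => rfl)

/-- Congruence of point representations with the same constant. [cite: KontsevichZagier2001, §1.2] -/
theorem pt_congr_mem_relations {r : ℝ} (Z Z' : IntegralRep 0) (hd : Z.domain = univ)
    (hd' : Z'.domain = univ) (hi : Z.integrand = fun _ => r) (hi' : Z'.integrand = fun _ => r) :
    of Z - of Z' ∈ relations :=
  of_sub_of_mem_relations_of_eqOn (hd'.trans hd.symm) (by rw [hi, hi']; exact fun _ _ => rfl)

/-! ## The Newton–Leibniz move over the point, for a `ℚ`-rational primitive -/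

/-- A one-variable rational function `t ↦ P(t)/Q(t)` (`P, Q ∈ ℚ[X]`, `Q ≠ 0` on `s`) read on the
first coordinate is a `ℚ`-semialgebraic function on any `ℚ`-semialgebraic `s ⊆ ℝ¹`.
[cite: BochnakCosteRoy1998, §2.2] -/
theorem isSemialgebraicFunOn_polynomial_div {s : Set (Fin 1 → ℝ)} (hs : IsSemialgebraic ℚ s)
    (P Q : ℚ[X]) (hQ : ∀ x ∈ s, (Polynomial.aeval (x 0) Q : ℝ) ≠ 0) :
    IsSemialgebraicFunOn ℚ s (fun x => (Polynomial.aeval (x 0) P : ℝ) / Polynomial.aeval (x 0) Q) := by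
  have hX : ∀ (x : Fin 1 → ℝ) (A : ℚ[X]), MvPolynomial.aeval x
      (Polynomial.aeval (MvPolynomial.X 0 : MvPolynomial (Fin 1) ℚ) A) =
        (Polynomial.aeval (x 0) A : ℝ) := by
    intro x A
    rw [← Polynomial.aeval_algHom_apply, MvPolynomial.aeval_X]
  refine (isSemialgebraicFunOn_aeval_div_aeval hs
    (Polynomial.aeval (MvPolynomial.X 0 : MvPolynomial (Fin 1) ℚ) P)
    (Polynomial.aeval (MvPolynomial.X 0 : MvPolynomial (Fin 1) ℚ) Q) fun x hx => ?_).congr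
    fun x _ => ?_
  · rw [hX]; exact hQ x hx
  · simp only [hX]

/-- The closed slab `{α ≤ x₀ ≤ β} ⊂ ℝ¹` with rational ends is `ℚ`-semialgebraic. [folklore] -/
theorem isSemialgebraic_Icc₁ (α β : ℚ) : IsSemialgebraic ℚ {x : Fin 1 → ℝ | x 0 ∈ Set.Icc (α:ℝ) β} := by
  have h1 := Literature.ModelTheory.ExponentialFields.isSemialgebraic_setOf_eval_nonneg (k := ℚ)
    (R := ℝ) (MvPolynomial.X 0 - MvPolynomial.C α : MvPolynomial (Fin 1) ℚ)
  have h2 := Literature.ModelTheory.ExponentialFields.isSemialgebraic_setOf_eval_nonneg (k := ℚ)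
    (R := ℝ) (MvPolynomial.C β - MvPolynomial.X 0 : MvPolynomial (Fin 1) ℚ)
  have hset : {x : Fin 1 → ℝ | x 0 ∈ Set.Icc (α:ℝ) β} =
      {x | 0 ≤ MvPolynomial.aeval x (MvPolynomial.X 0 - MvPolynomial.C α : MvPolynomial (Fin 1) ℚ)} ∩
        {x | 0 ≤ MvPolynomial.aeval x
          (MvPolynomial.C β - MvPolynomial.X 0 : MvPolynomial (Fin 1) ℚ)} := by
    ext x
    simp [sub_nonneg]
  rw [hset]
  exact h1.inter h2

/-- **Newton–Leibniz over the point** (rule 3, plus the null endpoints, rule 1a). Let `α ≤ β` be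
rational, `N = [(α,β), f]` an interval representation whose integrand `x ↦ f(x₀)` is
`ℚ`-semialgebraic on the closed slab, and `F = P_F/Q_F` (`P_F, Q_F ∈ ℚ[X]`, `Q_F ≠ 0` on `[α,β]`) a
primitive of `f` on `(α,β)`. Then `[N] − [pt, F(β) − F(α)] ∈ relations` for every point
representation with that constant. [cite: KontsevichZagier2001, §1.2 rule (3)] -/
theorem slab_sub_pt_mem_relations {α β : ℚ} (hαβ : α ≤ β) (f : ℝ → ℝ) (PF QF : ℚ[X])
    (hQF : ∀ t ∈ Set.Icc (α:ℝ) β, (Polynomial.aeval t QF : ℝ) ≠ 0)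
    (hderiv : ∀ t ∈ Set.Ioo (α:ℝ) β,
      HasDerivAt (fun u : ℝ => (Polynomial.aeval u PF : ℝ) / Polynomial.aeval u QF) (f t) t)
    (hf : IsSemialgebraicFunOn ℚ {x : Fin 1 → ℝ | x 0 ∈ Set.Icc (α:ℝ) β} (fun x => f (x 0)))
    (N : IntegralRep 1) (hNd : N.domain = {x | x 0 ∈ Set.Ioo (α:ℝ) β})
    (hNi : EqOn N.integrand (fun x => f (x 0)) N.domain)
    (Z : IntegralRep 0) (hZd : Z.domain = univ)
    (hZi : Z.integrand = fun _ => (Polynomial.aeval (β:ℝ) PF : ℝ) / Polynomial.aeval (β:ℝ) QF -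
      (Polynomial.aeval (α:ℝ) PF : ℝ) / Polynomial.aeval (α:ℝ) QF) :
    of N - of Z ∈ relations := by
  set F : ℝ → ℝ := fun u => (Polynomial.aeval u PF : ℝ) / Polynomial.aeval u QF with hF
  set C : Set (Fin 1 → ℝ) := {x | x 0 ∈ Set.Icc (α:ℝ) β} with hC
  have hCsa : IsSemialgebraic ℚ C := isSemialgebraic_Icc₁ α β
  -- the integrand `f` on the closed slab is integrable (it is `N.integrand` a.e.)
  have hfi : IntegrableOn (fun x : Fin 1 → ℝ => f (x 0)) C := by
    have h1 : IntegrableOn (fun x : Fin 1 → ℝ => f (x 0)) N.domain :=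
      N.integrableOn.congr_fun hNi (IsSemialgebraic.measurableSet_holds N.isSemialgebraic_domain)
    rw [hNd, integrableOn_fin_one] at h1
    rw [hC, integrableOn_fin_one]
    exact h1.congr_set_ae (Ioo_ae_eq_Icc (a := (α:ℝ)) (b := β)).symm
  -- the closed-slab representation `R = [[α,β], f]`
  obtain ⟨R, hRd, hRi⟩ : ∃ R : IntegralRep 1, R.domain = C ∧ R.integrand = fun x => f (x 0) :=
    ⟨⟨C, fun x => f (x 0), hCsa, hf, hfi⟩, rfl, rfl⟩
  have hs0 : ∀ (x : Fin 0 → ℝ) (t : ℝ), (Fin.snoc x t : Fin 1 → ℝ) 0 = t := fun _ _ => rfl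
  have hαβ' : (α:ℝ) ≤ β := by exact_mod_cast hαβ
  -- (i) ONE Newton–Leibniz move over `ℝ⁰`: `[R] − [Z] ∈ newtonLeibnizRel`, primitive `F (z 0)`
  have hNL : of R - of Z ∈ newtonLeibnizRel := by
    refine ⟨0, R, Z, fun _ => (α:ℝ), fun _ => (β:ℝ), fun z => F (z 0), ?_, ?_, ?_,
      fun _ _ => hαβ', ?_, ?_, ?_, ?_, rfl⟩
    · rw [hRd]
      exact isSemialgebraicFunOn_polynomial_div hCsa PF QF fun x hx => hQF (x 0) hx
    · rw [hZd]
      simpa using isSemialgebraicFunOn_aeval (isSemialgebraic_univ (k := ℚ) (ι := Fin 0) (R := ℝ))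
        (MvPolynomial.C α)
    · rw [hZd]
      simpa using isSemialgebraicFunOn_aeval (isSemialgebraic_univ (k := ℚ) (ι := Fin 0) (R := ℝ))
        (MvPolynomial.C β)
    · rw [hRd, hZd, hC]
      ext z
      simp only [Set.mem_setOf_eq, Set.mem_Icc, Set.mem_univ, true_and]
      rfl
    · -- continuity of `t ↦ F t` on the closed fibre
      intro x _
      simp only [hs0]
      exact ((Polynomial.continuous_aeval PF).continuousOn).div
        (Polynomial.continuous_aeval QF).continuousOn hQF
    · -- derivative on the open fibre
      intro x _ t ht
      rw [hRi]
      simp only [hs0]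
      exact hderiv t ht
    · intro x _
      rw [hZi]
      simp only [hs0]
      rfl
  -- (ii) closed slab versus the open slab `N.domain` (null endpoints), and congruence with `N`
  have hEsub : {x : Fin 1 → ℝ | x 0 ∈ Set.Ioo (α:ℝ) β} ⊆ R.domain := by
    rw [hRd, hC]
    exact fun x hx => Set.Ioo_subset_Icc_self hx
  have hnull : volume (R.domain \ {x : Fin 1 → ℝ | x 0 ∈ Set.Ioo (α:ℝ) β}) = 0 := by
    refine measure_mono_null (fun x hx => ?_)
      (measure_union_null (volume_setOf_apply_eq_zero (0 : Fin 1) (α:ℝ))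
        (volume_setOf_apply_eq_zero (0 : Fin 1) (β:ℝ)))
    rw [hRd, hC] at hx
    obtain ⟨⟨h1, h2⟩, h3⟩ := hx
    simp only [Set.mem_setOf_eq, Set.mem_Ioo, not_and, not_lt] at h3
    simp only [Set.mem_union, Set.mem_setOf_eq]
    rcases h1.lt_or_eq with h1 | h1
    · exact Or.inr (le_antisymm h2 (h3 h1))
    · exact Or.inl h1.symm
  have h2 : of R - of (R.restrict _ (isSemialgebraic_Ioo₁ α β) hEsub) ∈ relations :=
    R.of_sub_of_restrict_mem_relations (isSemialgebraic_Ioo₁ α β) hEsub hnull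
  have h3 : of (R.restrict _ (isSemialgebraic_Ioo₁ α β) hEsub) - of N ∈ relations :=
    of_sub_of_mem_relations_of_eqOn (by rw [hNd]; rfl) fun x hx => by
      rw [IntegralRep.integrand_restrict, hRi, hNi (by rw [hNd]; exact hx)]
  have : of N - of Z = (of R - of Z) - (of R - of (R.restrict _ (isSemialgebraic_Ioo₁ α β) hEsub)) -
      (of (R.restrict _ (isSemialgebraic_Ioo₁ α β) hEsub) - of N) := by abel
  rw [this]
  exact relations.sub_mem (relations.sub_mem (newtonLeibnizRel_subset_relations hNL) h2) h3

/-! ## Affine moves of either orientation -/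

/-- **Affine move** (rule 2), either orientation: if `Φ(x) = s x + t` (`s ≠ 0`, `s, t ∈ ℚ`) maps the
slab `N.domain = {u < x₀ < v}` onto `L.domain` and `N`'s integrand is the pull-back
`f(Φ x)·|s|` of `L`'s integrand `f`, then `[N] − [L] ∈ relations`.
[cite: KontsevichZagier2001, §1.2 rule (2)] -/
theorem affine_sub_mem_relations {s t : ℚ} (hs : s ≠ 0) (N L : IntegralRep 1) (f : ℝ → ℝ)
    (himage : L.domain = (fun y : Fin 1 → ℝ => fun _ : Fin 1 => (s:ℝ) * y 0 + t) '' N.domain)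
    (hLi : EqOn L.integrand (fun x => f (x 0)) L.domain)
    (hNi : EqOn N.integrand (fun x => f ((s:ℝ) * x 0 + t) * |(s:ℝ)|) N.domain) :
    of N - of L ∈ relations := by
  have hs' : (s:ℝ) ≠ 0 := by exact_mod_cast hs
  have hdet : |((s:ℝ) • ContinuousLinearMap.id ℝ (Fin 1 → ℝ)).det| = |(s:ℝ)| := by
    have : ((s:ℝ) • ContinuousLinearMap.id ℝ (Fin 1 → ℝ)).det = (s:ℝ) := by
      change LinearMap.det (((s:ℝ) • ContinuousLinearMap.id ℝ (Fin 1 → ℝ) :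
        (Fin 1 → ℝ) →L[ℝ] (Fin 1 → ℝ)) : (Fin 1 → ℝ) →ₗ[ℝ] (Fin 1 → ℝ)) = (s:ℝ)
      rw [ContinuousLinearMap.toLinearMap_smul, ContinuousLinearMap.coe_id,
        LinearMap.det_smul, LinearMap.det_id, Module.finrank_fin_fun]
      ring
    rw [this]
  refine changeOfVariablesRel_subset_relations
    ⟨1, N, L, fun y : Fin 1 → ℝ => fun _ : Fin 1 => (s:ℝ) * y 0 + t,
      fun _ => (s:ℝ) • ContinuousLinearMap.id ℝ (Fin 1 → ℝ),
      aff_isSemialgebraicMapOn_chart N.isSemialgebraic_domain (isAlgebraic_algebraMap t)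
        (isAlgebraic_algebraMap s),
      fun x _ => (aff_hasFDerivAt_chart (s:ℝ) t x).hasFDerivWithinAt,
      (aff_injective_chart hs' (t:ℝ)).injOn, himage, fun x hx => ?_, rfl⟩
  have hΦx : (fun _ : Fin 1 => (s:ℝ) * x 0 + t) ∈ L.domain := himage ▸ Set.mem_image_of_mem _ hx
  rw [hNi hx, hLi hΦx, hdet]

/-- The image of a slab under an increasing affine map `y ↦ s·y + t` (`0 < s`). [folklore] -/
theorem image_affine_slab_of_pos {s : ℝ} (hs : 0 < s) (t u v : ℝ) :
    (fun y : Fin 1 → ℝ => fun _ : Fin 1 => s * y 0 + t) '' {x : Fin 1 → ℝ | x 0 ∈ Set.Ioo u v} =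
      {x : Fin 1 → ℝ | x 0 ∈ Set.Ioo (s * u + t) (s * v + t)} := by
  ext y
  constructor
  · rintro ⟨x, hx, rfl⟩
    simp only [Set.mem_setOf_eq, Set.mem_Ioo] at hx ⊢
    constructor <;> nlinarith [hx.1, hx.2]
  · intro hy
    simp only [Set.mem_setOf_eq, Set.mem_Ioo] at hy
    refine ⟨fun _ => (y 0 - t) / s, ?_, ?_⟩
    · simp only [Set.mem_setOf_eq, Set.mem_Ioo]
      rw [lt_div_iff₀ hs, div_lt_iff₀ hs]
      constructor <;> nlinarith [hy.1, hy.2]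
    · funext i
      obtain rfl : i = 0 := Fin.fin_one_eq_zero i
      field_simp
      ring

/-- The image of a slab under a decreasing affine map `y ↦ s·y + t` (`s < 0`). [folklore] -/
theorem image_affine_slab_of_neg {s : ℝ} (hs : s < 0) (t u v : ℝ) :
    (fun y : Fin 1 → ℝ => fun _ : Fin 1 => s * y 0 + t) '' {x : Fin 1 → ℝ | x 0 ∈ Set.Ioo u v} =
      {x : Fin 1 → ℝ | x 0 ∈ Set.Ioo (s * v + t) (s * u + t)} := by
  ext y
  constructor
  · rintro ⟨x, hx, rfl⟩
    simp only [Set.mem_setOf_eq, Set.mem_Ioo] at hx ⊢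
    constructor <;> nlinarith [hx.1, hx.2]
  · intro hy
    simp only [Set.mem_setOf_eq, Set.mem_Ioo] at hy
    refine ⟨fun _ => (y 0 - t) / s, ?_, ?_⟩
    · simp only [Set.mem_setOf_eq, Set.mem_Ioo]
      rw [div_lt_iff_of_neg hs, lt_div_iff_of_neg hs]
      constructor <;> nlinarith [hy.1, hy.2]
    · have hs' : s ≠ 0 := hs.ne
      funext i
      obtain rfl : i = 0 := Fin.fin_one_eq_zero i
      field_simp
      ring

/-! ## Representations on the open unit slab with a rational integrand -/

/-- The representation `[(0,1), P/Q]` for `P, Q ∈ ℚ[X]` with `Q ≠ 0` on `[0,1]` exists (continuous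
integrand on the compact slab). [cite: KontsevichZagier2001, §1.1] -/
theorem exists_rep_unit (P Q : ℚ[X]) (hQ : ∀ t ∈ Set.Icc (0:ℝ) 1, (Polynomial.aeval t Q : ℝ) ≠ 0) :
    ∃ N : IntegralRep 1, N.domain = {x | x 0 ∈ Set.Ioo (0:ℝ) 1} ∧
      N.integrand = fun x => (Polynomial.aeval (x 0) P : ℝ) / Polynomial.aeval (x 0) Q := by
  have hdom : IsSemialgebraic ℚ {x : Fin 1 → ℝ | x 0 ∈ Set.Ioo (0:ℝ) 1} := by
    simpa using isSemialgebraic_Ioo₁ 0 1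
  have hsa := isSemialgebraicFunOn_polynomial_div hdom P Q fun x hx =>
    hQ (x 0) (Set.Ioo_subset_Icc_self hx)
  have hint : IntegrableOn (fun x : Fin 1 → ℝ => (Polynomial.aeval (x 0) P : ℝ) /
      Polynomial.aeval (x 0) Q) {x : Fin 1 → ℝ | x 0 ∈ Set.Ioo (0:ℝ) 1} := by
    rw [integrableOn_fin_one]
    have hc : ContinuousOn (fun t : ℝ => (Polynomial.aeval t P : ℝ) / Polynomial.aeval t Q)
        (Set.Icc (0:ℝ) 1) :=
      (Polynomial.continuous_aeval P).continuousOn.div (Polynomial.continuous_aeval Q).continuousOn hQ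
    exact (hc.integrableOn_compact isCompact_Icc).mono_set Set.Ioo_subset_Icc_self
  exact ⟨⟨_, _, hdom, hsa, hint⟩, rfl, rfl⟩

end Dlog

end Summit.KontsevichZagierPeriods.HurwitzMicroSectors.NormalFormPrinciple.PiBox
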